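/-
Origin: expansion seat `planner-pub-hodgecm-pv11-g6-0`, handover #2 2026-08-18T09:46:54Z (`HOME/pub-hodgecm-pv11-g6/lean/Pv11g6/ArchATypeDictionary.lean`, md5 ddb95d33, 171 lines);
landed by the gen-7 packager in gate run 28 as `HodgeCM/PerL34/ArchATypeDictionary.lean` (import ^import Pv[0-9]+g[0-9]+\.→import HodgeCM.PerL34. ×2).
-/
/-
Copyright: pub-hodgecm cell, unit pub-hodgecm-pv11-g6 (DAG-NODE PROVER #11, gen 6), node #2. Mathlib + tree only.
Origin / target: `HOME/pub-hodgecm-pv11-g6/lean/Pv11g6/ArchATypeDictionary.lean` → `HodgeCM/PerL34/ArchATypeDictionary.lean`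
(packager rewrites `import Pv02g6.ArchAWeilGenuine` ↦ `import HodgeCM.PerL34.ArchAWeilGenuine` (pv02-g6 HANDOVER #2,
decf27f9bf57) and `import Pv11g6.SeesawCharTypes` ↦ `import HodgeCM.PerL34.SeesawCharTypes` (pv11-g6 HANDOVER #1,
9c588437c460); lands AFTER both).  Requested by pv02-g6 (STATUS 09:33:39Z "FOLLOW-UP"), taken by pv11-g6 (09:43:02Z).
-/
import Summits.HodgeConjecture.HodgeCM.PerL34.ArchAWeilGenuine
import Summits.HodgeConjecture.HodgeCM.PerL34.SeesawCharTypes_2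

/-!
# Lemma 4.1(a)'s output, literally: "`χ′_i` has infinity type `e(Ψ_i)`"

PerL v5 (paper-v5-d912a121.tex), verbatim fragments: l. 481 (Lemma 4.1(a)) "then $\chi'_{i,b}(u)=u^{e_b(\Psi_i)}$
for all $b$"; l. 530 (Lemma 4.2(b)) "and $\chi'_i$ has infinity type $e(\Psi_i)$ (Lemma~\ref{lem:arch}(a))";
ll. 644–645 (§4.3) "For an automorphic character $\chi'_i$ of $[\U(W_i)]$ of archimedean type $e(\Psi_i)$".

pv02's rendering of N27 (`HodgeCM.PerL34.ArchA.LineArchData.N27_statement`, r19; over PerL's genuine torus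
`U(W_i)(𝔸) = relNormOneIdeles L⁺ L`: `HodgeCM.PerL34.ArchAWeil.N27_genuine`, pv02-g6) concludes with the LOCAL
condition `LocMatches χ′ := ∀ b u, χ′_{i,b}(u) = u ^ (e b)`, `e b = - kJ b` the datum's exponent function
(`ArchA.LineArchData.e`, l. 476).  pv11-g6's `SeesawCharTypes` gives every automorphic character `χ′` of `[U(W_i)]`
ITS infinity type `NumberField.SeesawTorus.infinityType χ′ : InfinitePlace L → ℤ`, real-place indexed
`infinityTypeReal χ′ : InfinitePlace L⁺ → ℤ`.  This leaf composes the two BY NAME, so that N27's output reads as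
print's l. 530 / l. 644 phrase:

* **`locMatches_iff_infinityTypeReal_eq_e`** — `(lineData M ι₁ (realPlaceCircle L) kJ).LocMatches χ′ ↔
  infinityTypeReal χ′ = (lineData M ι₁ (realPlaceCircle L) kJ).e`: N27's local condition says exactly
  "`χ′` has infinity type `e = (e_b)_b`";  `locMatches_iff_infinityTypeReal_eq` (`… = fun b => - kJ b`) and
  `locMatches_iff_infinityType_eq` (indexed by the places of `L`:
  `infinityType χ′ = (fun b => - kJ b) ∘ IsCMField.equivInfinitePlace L`);
* **`N27_genuine_infinityType`** — N27 over the genuine torus (binder list = the Weil theta MODEL `M` only, as in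
  pv02-g6) with hypothesis / conclusion phrased through the type: (⇒) a non-vanishing lift with components in
  `J⁺ ⊗ 𝟏^{⊗}` forces `infinityTypeReal χ′ = e`; (⇐) for `χ′` of infinity type `e` only the `J⁺` / `𝟏` weight spaces
  contribute; `N27_genuine_infinityType_finite` the `OrbitFinite` form;
* **`kJ_eq_neg_infinityTypeReal`** — the [BW] weights are READ OFF a matching character:
  `LocMatches χ′ → kJ = fun b => - infinityTypeReal χ′ b` (pv02-g6's `kJ_eq_of_locMatches` = "`infinityTypeReal` is a
  function");
* **`setOf_locMatches_eq_preimage`** — the characters matching the datum are a FIBRE of the type map: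
  `{χ′ | LocMatches χ′} = infinityTypeReal ⁻¹' {e}`; every fibre is nonempty (`SeesawTorus.infinityTypeReal_surjective`,
  = Lemma 4.2(a)), recovering pv02-g6's `exists_char_locMatches`.

Nothing cited, nothing posited; no statement of PerL / QW8 / the 2001 programme is a hypothesis.
-/

set_option autoImplicit false

noncomputable section

open Topology

namespace HodgeCM
namespace PerL34
namespace ArchAWeil

open ArchA NumberField NumberField.SeesawTorus

variable {GU : Type} [Group GU] [TopologicalSpace GU] [IsTopologicalGroup GU] {ΓU : Subgroup GU}
  [CompactSpace (GU ⧸ ΓU)]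
variable (L : Type) [Field L] [NumberField L] [IsCMField L]

local notation "L⁺" => maximalRealSubfield L

variable (M : WeilThetaModel GU ΓU (relNormOneIdeles (maximalRealSubfield L) L) (relNormOneRat (maximalRealSubfield L) L))
  (ι₁ : InfinitePlace (maximalRealSubfield L)) (kJ : InfinitePlace (maximalRealSubfield L) → ℤ)

/-! ## §1  `LocMatches χ′` ↔ "χ′ has infinity type e" -/

/-- N27's local condition, indexed by the places `w` of `L`: `χ′` has infinity type `w ↦ -kJ (w|_{L⁺})`. -/
theorem locMatches_iff_infinityType_eq (χ : PontryaginDual (relNormOneIdeles L⁺ L ⧸ relNormOneRat L⁺ L)) :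
    (lineData M ι₁ (realPlaceCircle L) kJ).LocMatches χ ↔
      infinityType χ = (fun b => - kJ b) ∘ IsCMField.equivInfinitePlace L :=
  (locMatches_iff_hasArchType L M ι₁ kJ χ).trans (hasArchType_iff_infinityType_eq χ _)

/-- N27's local condition, indexed by the real places `b` of `L₀ = L⁺`: `infinityTypeReal χ′ = (b ↦ -kJ b)`. -/
theorem locMatches_iff_infinityTypeReal_eq (χ : PontryaginDual (relNormOneIdeles L⁺ L ⧸ relNormOneRat L⁺ L)) :
    (lineData M ι₁ (realPlaceCircle L) kJ).LocMatches χ ↔ infinityTypeReal χ = fun b => - kJ b := by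
  rw [locMatches_iff_infinityType_eq, ← infinityTypeReal_comp_equivInfinitePlace]
  exact (IsCMField.equivInfinitePlace L).surjective.injective_comp_right.eq_iff

/-- **l. 530 literally**: N27's local condition `χ′_{i,b}(u) = u^{e_b}` (all `b`) says exactly "`χ′` has infinity type
`e`", `e = (e_b)_b` the exponent function of the datum (`ArchA.LineArchData.e`, l. 476: `e_b = -kJ b`). -/
theorem locMatches_iff_infinityTypeReal_eq_e (χ : PontryaginDual (relNormOneIdeles L⁺ L ⧸ relNormOneRat L⁺ L)) :
    (lineData M ι₁ (realPlaceCircle L) kJ).LocMatches χ ↔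
      infinityTypeReal χ = (lineData M ι₁ (realPlaceCircle L) kJ).e :=
  locMatches_iff_infinityTypeReal_eq L M ι₁ kJ χ

/-- The [BW] weights of a datum matched by `χ′` are read off the character: `kJ b = - e_b(χ′)`. -/
theorem kJ_eq_neg_infinityTypeReal (χ : PontryaginDual (relNormOneIdeles L⁺ L ⧸ relNormOneRat L⁺ L))
    (h : (lineData M ι₁ (realPlaceCircle L) kJ).LocMatches χ) : kJ = fun b => - infinityTypeReal χ b := by
  have hk := (locMatches_iff_infinityTypeReal_eq L M ι₁ kJ χ).mp h
  funext b
  have hb : infinityTypeReal χ b = - kJ b := congrFun hk b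
  omega

/-- pv02-g6's `kJ_eq_of_locMatches`, now one line: two matched weight vectors are both `- infinityTypeReal χ′`. -/
theorem kJ_eq_of_locMatches' {kJ kJ' : InfinitePlace L⁺ → ℤ}
    (χ : PontryaginDual (relNormOneIdeles L⁺ L ⧸ relNormOneRat L⁺ L))
    (h : (lineData M ι₁ (realPlaceCircle L) kJ).LocMatches χ)
    (h' : (lineData M ι₁ (realPlaceCircle L) kJ').LocMatches χ) : kJ = kJ' :=
  (kJ_eq_neg_infinityTypeReal L M ι₁ kJ χ h).trans (kJ_eq_neg_infinityTypeReal L M ι₁ kJ' χ h').symm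

/-- The characters matching the datum are the FIBRE of the real-place type map over `e = (b ↦ -kJ b)`. -/
theorem setOf_locMatches_eq_preimage :
    {χ | (lineData M ι₁ (realPlaceCircle L) kJ).LocMatches χ} =
      (infinityTypeReal : PontryaginDual (relNormOneIdeles L⁺ L ⧸ relNormOneRat L⁺ L) → InfinitePlace L⁺ → ℤ) ⁻¹'
        {fun b => - kJ b} := by
  ext χ
  exact locMatches_iff_infinityTypeReal_eq L M ι₁ kJ χ

/-- Every fibre is inhabited (Lemma 4.2(a) = `SeesawTorus.infinityTypeReal_surjective`): pv02-g6's
`exists_char_locMatches` recovered through the type map. -/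
theorem setOf_locMatches_nonempty : {χ | (lineData M ι₁ (realPlaceCircle L) kJ).LocMatches χ}.Nonempty := by
  obtain ⟨χ, hχ⟩ := infinityTypeReal_surjective (L := L) fun b => - kJ b
  exact ⟨χ, (locMatches_iff_infinityTypeReal_eq L M ι₁ kJ χ).mpr hχ⟩

/-- A character of infinity type `e` matches the datum with weights `kJ := -e` — every automorphic character of
`[U(W_i)]` is matched by exactly one weight vector. -/
theorem locMatches_neg_infinityTypeReal (χ : PontryaginDual (relNormOneIdeles L⁺ L ⧸ relNormOneRat L⁺ L)) :
    (lineData M ι₁ (realPlaceCircle L) fun b => - infinityTypeReal χ b).LocMatches χ :=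
  (locMatches_iff_infinityTypeReal_eq L M ι₁ _ χ).mpr (funext fun b => by simp)

/-- (Ported verbatim from the HodgeCMPerL package; no docstring in the source.) -/
theorem existsUnique_kJ_locMatches (χ : PontryaginDual (relNormOneIdeles L⁺ L ⧸ relNormOneRat L⁺ L)) :
    ∃! kJ' : InfinitePlace L⁺ → ℤ, (lineData M ι₁ (realPlaceCircle L) kJ').LocMatches χ :=
  ⟨fun b => - infinityTypeReal χ b, locMatches_neg_infinityTypeReal L M ι₁ χ,
    fun kJ' h => kJ_eq_neg_infinityTypeReal L M ι₁ kJ' χ h⟩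

/-! ## §2  N27 over the genuine torus, phrased through the infinity type -/

/-- **N27 (PerL v5 Lemma 4.1(a)) over the genuine torus, through the type map** (binder list = the MODEL `M`):
for every automorphic character `χ′` of `[U(W_i)]`, (⇒) if some `θ(φ,χ′) ≠ 0` and the lift has archimedean
components in `J⁺ ⊗ 𝟏^{⊗}` then `χ′` has infinity type `e` (`infinityTypeReal χ′ = e`, l. 530's phrase);
(⇐) if `χ′` has infinity type `e` then only the `J⁺` / `𝟏` weight spaces contribute to its theta lifts. -/
theorem N27_genuine_infinityType (χ : PontryaginDual (relNormOneIdeles L⁺ L ⧸ relNormOneRat L⁺ L)) :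
    ((∃ φ, (lineData (M.kFinite (realPlaceCircle L)) ι₁ (realPlaceCircle L) kJ).lift χ φ ≠ 0) →
        (lineData (M.kFinite (realPlaceCircle L)) ι₁ (realPlaceCircle L) kJ).HasArchJ χ →
          infinityTypeReal χ = (lineData (M.kFinite (realPlaceCircle L)) ι₁ (realPlaceCircle L) kJ).e) ∧
      (infinityTypeReal χ = (lineData (M.kFinite (realPlaceCircle L)) ι₁ (realPlaceCircle L) kJ).e →
        (lineData (M.kFinite (realPlaceCircle L)) ι₁ (realPlaceCircle L) kJ).HasArchJ χ) := by
  have h27 := N27_genuine L M ι₁ kJ χ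
  rw [locMatches_iff_infinityTypeReal_eq_e L (M.kFinite (realPlaceCircle L)) ι₁ kJ χ] at h27
  exact h27

/-- The same over a given `K`-finite index space (`OrbitFinite` as hypothesis, no sub-model). -/
theorem N27_genuine_infinityType_finite (hfin : OrbitFinite M (realPlaceCircle L))
    (χ : PontryaginDual (relNormOneIdeles L⁺ L ⧸ relNormOneRat L⁺ L)) :
    ((∃ φ, (lineData M ι₁ (realPlaceCircle L) kJ).lift χ φ ≠ 0) →
        (lineData M ι₁ (realPlaceCircle L) kJ).HasArchJ χ →
          infinityTypeReal χ = (lineData M ι₁ (realPlaceCircle L) kJ).e) ∧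
      (infinityTypeReal χ = (lineData M ι₁ (realPlaceCircle L) kJ).e →
        (lineData M ι₁ (realPlaceCircle L) kJ).HasArchJ χ) := by
  have h27 := N27_genuine_finite L M ι₁ kJ hfin χ
  rw [locMatches_iff_infinityTypeReal_eq_e L M ι₁ kJ χ] at h27
  exact h27

/-- (⇒) alone, in words: a character with a non-vanishing theta lift of archimedean type `J⁺ ⊗ 𝟏^{⊗}` HAS infinity
type `e`; in particular its real-place exponents are `e_b = -kJ b` (`SeesawTorus.apply_realPlaceCircleQuot`). -/
theorem infinityTypeReal_eq_of_lift_ne_zero (χ : PontryaginDual (relNormOneIdeles L⁺ L ⧸ relNormOneRat L⁺ L))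
    (hne : ∃ φ, (lineData (M.kFinite (realPlaceCircle L)) ι₁ (realPlaceCircle L) kJ).lift χ φ ≠ 0)
    (hJ : (lineData (M.kFinite (realPlaceCircle L)) ι₁ (realPlaceCircle L) kJ).HasArchJ χ) :
    infinityTypeReal χ = fun b => - kJ b :=
  (N27_genuine_infinityType L M ι₁ kJ χ).1 hne hJ

/-- (⇐) alone: for a character of infinity type `b ↦ -kJ b` only the `J⁺` / `𝟏` weight spaces contribute. -/
theorem hasArchJ_of_infinityTypeReal_eq (χ : PontryaginDual (relNormOneIdeles L⁺ L ⧸ relNormOneRat L⁺ L))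
    (h : infinityTypeReal χ = fun b => - kJ b) :
    (lineData (M.kFinite (realPlaceCircle L)) ι₁ (realPlaceCircle L) kJ).HasArchJ χ :=
  (N27_genuine_infinityType L M ι₁ kJ χ).2 h

end ArchAWeil
end PerL34
end HodgeCM
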